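import Literature.LinearAlgebra.Matrix.CyclotomicIntegerMatrixClassesTwentyThree
import HarnessLib

/-!
# Kummer meets Latimer–MacDuffee: primes `p` for which the elements of order `p` of `GL_{p−1}(ℤ)` fall into
# MANY conjugacy classes — `p ∣ num B_k ⟹ p ∣ #classes`; `h(ℚ(√−p)) ∣ #classes`; `p = 31, 37, 47, 59, 67, 71, 103, 691`

[topic LinearAlgebra/Matrix] Lane `lit-hodgefound` (Track 2 foundations library), seat p15 generation 39, row g39-#7 —
g39-#2 `CyclotomicIntegerMatrixClasses.natCard_quot_isConj_orderOf_eq_prime` counts the conjugacy classes of elements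
of prime order `p` of `GL_{p−1}(ℤ) = (M_{p−1}(ℤ))ˣ` by `h(ℚ(ζ_p))` (Latimer–MacDuffee–Taussky for `f = Φ_p`); g39-#5
drew `≥ 3` classes for `p = 23`.  This file feeds the tree's class-number DIVISIBILITIES into that count:
Kummer's criterion (`Literature.NumberTheory.LFunctions.KummerCriterionMinusPart`: `p ∣ num B_k ⟹ p ∣ h(ℚ(ζ_p))`,
the examples `37, 59, 67, 103, 691`, and «infinitely many such `p`»), and Okazaki's `h(ℚ(√−p)) ∣ h⁻(ℚ(ζ_p))`
(`Literature.NumberTheory.LFunctions.QuadraticClassNumberDvdMinusClassNumber`, examples `31, 47, 59, 71`).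
THEOREMS ONLY (no definition, no instance, no named fact; D-0026 net Literature debt `0`; no `sorry`).

## Sources, VERBATIM

* J. Brzeziński, *On two classical theorems in the theory of orders*, J. Number Theory 34 (1990) 21–32 [Brzezinski1990]
  (held `paper:doi-10-1016-0022-314x-90-90049-w`, p0001), **(0.1) THEOREM** (Latimer–MacDuffee 1933, Taussky 1949):
  «Let `Λ = M_n(ℤ)` and let `S = ℤ[θ]`, where `f(θ) = 0` for a monic separable polynomial `f ∈ ℤ[X]` of degree `n`.
  Then there is a one-to-one correspondence between the `Λ* = GL_n(ℤ)`-orbits on the (ring-)embeddings of `S` into `Λ`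
  and the ideal classes of `S`. […] the action of `Λ*` is defined by conjugation.»  (`f = Φ_p`, `n = p − 1`.)
* H. M. Edwards, *Fermat's Last Theorem* [EdwardsFermat1977], §6.16 Theorem (Kummer: `λ ∣ h` iff `λ` divides the
  numerator of one of `B_2, …, B_{λ−3}`), §6.15 («37 divides the first factor of its class number»), §6.19 («less than
  100 except possibly for 37, 59, and 67»); K. Ireland, M. Rosen [IrelandRosen1982], Ch. 15 §1 («The first few
  irregular primes are 37, 59, 67, 101, 103, 149 and 157»; «ord_37(B_32) = 1»); L. C. Washington [Washington1997],
  Thm. 5.16 (Kummer), Thm. 5.17 («There are infinitely many irregular primes»), tables of §11.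
* R. Okazaki, *On evaluation of L-functions over real quadratic fields / relative class numbers* [Okazaki2000], §5
  Cor. 29 (`h(ℚ(√−p)) ∣ h⁻(ℚ(ζ_p))`, `p ≡ 3 (mod 4)`, `p > 3`); H. Cohen [Cohen1993], Appendix B.1 (table:
  `h(−23) = 3`, `h(−31) = 3`, `h(−47) = 5`, `h(−59) = 3`, `h(−71) = 7`).

All number-theoretic inputs are the tree's PROVED theorems named in the docstrings; this file only transports them
through g39-#2's count.

## What is formalised (`C_p :=` the set of conjugacy classes of elements of order `p` of `GL_{p−1}(ℤ)`)

* §1 `natCard_quot_isConj_orderOf_eq_prime_eq_classNumber` (`#C_p = h(K)` for any `p`-th cyclotomic field `K`),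
  **`dvd_natCard_quot_isConj_orderOf_eq_prime_of_dvd_bernoulli_num`** (`p ∣ num B_k ⟹ p ∣ #C_p`),
  `exists_fun_pairwise_not_isConj_of_dvd_bernoulli_num` (then `p` pairwise non-conjugate elements of order `p`),
  **`infinite_setOf_prime_dvd_natCard_quot_isConj_orderOf_eq`** (infinitely many primes `p` with `p ∣ #C_p`),
  **`classNumber_dvd_natCard_quot_isConj_orderOf_eq_prime_of_sq_eq_neg`** (`h(ℚ(√−p)) ∣ #C_p`, `p ≡ 3 (4)`, `p > 3`).
* §2 instances: `#C_31`: `3 ∣`; `#C_37`: `37 ∣` and `37` pairwise non-conjugate elements of order `37` in `GL_36(ℤ)`;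
  `#C_47`: `5 ∣`; `#C_59`: `3 · 59 ∣`; `#C_67`: `67 ∣`; `#C_71`: `7 ∣`; `#C_103`: `103 ∣`; `#C_691`: `691 ∣` — each with
  the `≤` form.

Not here: exact values of `#C_p` (no exact class number `h(ℚ(ζ_p)) > 1` is in the tree), `p = 101, 149, 157`.

## References
* [Brzezinski1990] J. Brzeziński, J. Number Theory 34 (1990) 21–32, (0.1) Theorem. [cite: Brzezinski1990, (0.1) Theorem, p. 21]
* [Taussky1949] O. Taussky, Canad. J. Math. 1 (1949) 300–302, Thms. 1–4.
* [EdwardsFermat1977] H. M. Edwards, *Fermat's Last Theorem*, GTM 50, §§6.15–6.19.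
* [IrelandRosen1982] K. Ireland, M. Rosen, *A Classical Introduction to Modern Number Theory*, Ch. 15 §1.
* [Washington1997] L. C. Washington, *Introduction to Cyclotomic Fields*, 2nd ed., Thms. 5.16, 5.17, tables §11.
* [Okazaki2000] R. Okazaki, §5 Cor. 29.
* [Cohen1993] H. Cohen, *A Course in Computational Algebraic Number Theory*, Appendix B.1.
-/

noncomputable section

open scoped Classical nonZeroDivisors NumberField
open Polynomial Module Submodule NumberField

namespace Literature.LinearAlgebra.Matrix.CyclotomicIntegerMatrixClassesIrregularPrimes

open Literature.LinearAlgebra.Matrix.CyclotomicIntegerMatrixClasses (natCard_quot_isConj_orderOf_eq_prime)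
open Literature.NumberTheory.LFunctions.QuadraticClassNumberDvdMinusClassNumber
  (classNumber_dvd_classNumber_div_of_sq_eq_neg three_dvd_classNumber_div_thirtyOne
    five_dvd_classNumber_div_fortySeven three_mul_fiftyNine_dvd_classNumber_div_fiftyNine
    seven_dvd_classNumber_div_seventyOne)
open Literature.NumberTheory.LFunctions.KummerCriterion
  (dvd_classNumber_of_dvd_bernoulli_num exists_gt_prime_dvd_classNumber_cyclotomicField
    classNumber_maximalRealSubfield_dvd dvd_classNumber_cyclotomicField_thirtySeven
    dvd_classNumber_cyclotomicField_fiftyNine dvd_classNumber_cyclotomicField_sixtySeven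
    dvd_classNumber_cyclotomicField_oneHundredThree dvd_classNumber_cyclotomicField_sixHundredNinetyOne)

/-! ## §0 Plumbing -/

/-- If a quotient `Quot r` has at least `k` elements, there are `k` representatives no two of which are `r`-related
(related elements have equal classes). [folklore] (proved here; private helper) -/
private theorem exists_fun_pairwise_not_rel {α : Type*} {r : α → α → Prop} {k : ℕ} (hk : k ≤ Nat.card (Quot r)) :
    ∃ f : Fin k → α, Pairwise fun i j => ¬ r (f i) (f j) := by
  rcases Nat.eq_zero_or_pos k with rfl | hkpos
  · exact ⟨fun i => i.elim0, fun i => i.elim0⟩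
  have hne : Nat.card (Quot r) ≠ 0 := by omega
  let e : Quot r ≃ Fin (Nat.card (Quot r)) := Nat.equivFinOfCardPos hne
  let q : Fin k → Quot r := fun i => e.symm (Fin.castLE hk i)
  have hq : Function.Injective q := fun i j hij => Fin.castLE_injective hk (e.symm.injective hij)
  choose f hf using fun i => Quot.exists_rep (q i)
  refine ⟨f, fun i j hij h => hij (hq ?_)⟩
  rw [← hf i, ← hf j]
  exact Quot.sound h

/-! ## §1 The count `#C_p = h(ℚ(ζ_p))` against the tree's class-number divisibilities -/

section General

variable {p : ℕ} [hp : Fact p.Prime]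

/-- **`#C_p = h(K)`**: the number of conjugacy classes of elements of order `p` of `GL_{p−1}(ℤ)` is the class NUMBER
of any `p`-th cyclotomic field `K` (g39-#2's count, read through `classNumber K = #Cl(𝒪_K)`).
[cite: Brzezinski1990, (0.1) Theorem (with `f = Φ_p`, `n = p − 1`), p. 21] [cite: Taussky1949, Thms. 1–4] -/
theorem natCard_quot_isConj_orderOf_eq_prime_eq_classNumber (K : Type) [Field K] [NumberField K]
    [IsCyclotomicExtension {p} ℚ K] :
    Nat.card (Quot (fun g g' : {g : (_root_.Matrix (Fin (p - 1)) (Fin (p - 1)) ℤ)ˣ // orderOf g = p} =>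
        IsConj g.1 g'.1)) = classNumber K :=
  natCard_quot_isConj_orderOf_eq_prime (p := p) K

/-- `k ∣ h(K)` for some `p`-th cyclotomic field `K` ⟹ `k ∣ #C_p` and `k ≤ #C_p`. [cite: Brzezinski1990, (0.1) Theorem, p. 21] (transport; private) -/
private theorem dvd_and_le_natCard_of_dvd_classNumber {k : ℕ} (K : Type) [Field K] [NumberField K]
    [IsCyclotomicExtension {p} ℚ K] (h : k ∣ classNumber K) :
    k ∣ Nat.card (Quot (fun g g' : {g : (_root_.Matrix (Fin (p - 1)) (Fin (p - 1)) ℤ)ˣ // orderOf g = p} =>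
        IsConj g.1 g'.1)) ∧
      k ≤ Nat.card (Quot (fun g g' : {g : (_root_.Matrix (Fin (p - 1)) (Fin (p - 1)) ℤ)ˣ // orderOf g = p} =>
        IsConj g.1 g'.1)) := by
  rw [natCard_quot_isConj_orderOf_eq_prime_eq_classNumber K]
  exact ⟨h, Nat.le_of_dvd (classNumber_pos K) h⟩

/-- `h⁻ ∣ h`: a divisor of `h(K)/h(K⁺)` divides `h(K)` (`K` a `p`-th cyclotomic field, `p` odd; the tree's
`KummerCriterion.classNumber_maximalRealSubfield_dvd`). [cite: Washington1997, Thm. 4.10 (`h⁺ ∣ h`, the CM case)] (private helper) -/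
private theorem dvd_classNumber_of_dvd_div {k : ℕ} (hp2 : p ≠ 2) (K : Type) [Field K] [NumberField K]
    [IsCyclotomicExtension {p} ℚ K] (h : k ∣ classNumber K / classNumber (maximalRealSubfield K)) :
    k ∣ classNumber K := by
  haveI : NeZero p := ⟨hp.out.ne_zero⟩
  have h2 : 2 < p := lt_of_le_of_ne hp.out.two_le (Ne.symm hp2)
  exact h.trans (Nat.div_dvd_of_dvd (classNumber_maximalRealSubfield_dvd (N := p) K h2))

/-- **KUMMER ⟹ MANY CLASSES.  If the odd prime `p` divides the numerator of a Bernoulli number `B_k`, `k` even,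
`2 ≤ k ≤ p − 3`, then `p` divides the number of conjugacy classes of elements of order `p` of `GL_{p−1}(ℤ)`**
(`p ∣ h(ℚ(ζ_p))` by Kummer's criterion — the tree's `KummerCriterion.dvd_classNumber_of_dvd_bernoulli_num` — and
`#C_p = h(ℚ(ζ_p))`). [cite: EdwardsFermat1977, §6.16, Theorem] [cite: Washington1997, Thm. 5.16] [cite: Brzezinski1990, (0.1) Theorem (with `f = Φ_p`), p. 21] -/
theorem dvd_natCard_quot_isConj_orderOf_eq_prime_of_dvd_bernoulli_num (hp2 : p ≠ 2) {k : ℕ} (hk : Even k)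
    (h2k : 2 ≤ k) (hkp : k + 3 ≤ p) (hdvd : (p : ℤ) ∣ (_root_.bernoulli k).num) :
    p ∣ Nat.card (Quot (fun g g' : {g : (_root_.Matrix (Fin (p - 1)) (Fin (p - 1)) ℤ)ˣ // orderOf g = p} =>
        IsConj g.1 g'.1)) := by
  haveI : IsCyclotomicExtension {p} ℚ (CyclotomicField p ℚ) := CyclotomicField.isCyclotomicExtension p ℚ
  exact (dvd_and_le_natCard_of_dvd_classNumber (CyclotomicField p ℚ)
    (dvd_classNumber_of_dvd_bernoulli_num hp2 (CyclotomicField p ℚ) hk h2k hkp hdvd)).1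

/-- **… and then `GL_{p−1}(ℤ)` contains `p` elements of order `p` that are pairwise non-conjugate.**
[cite: EdwardsFermat1977, §6.16, Theorem] [cite: Brzezinski1990, (0.1) Theorem (with `f = Φ_p`), p. 21] -/
theorem exists_fun_pairwise_not_isConj_of_dvd_bernoulli_num (hp2 : p ≠ 2) {k : ℕ} (hk : Even k)
    (h2k : 2 ≤ k) (hkp : k + 3 ≤ p) (hdvd : (p : ℤ) ∣ (_root_.bernoulli k).num) :
    ∃ g : Fin p → (_root_.Matrix (Fin (p - 1)) (Fin (p - 1)) ℤ)ˣ,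
      (∀ i, orderOf (g i) = p) ∧ Pairwise fun i j => ¬ IsConj (g i) (g j) := by
  haveI : IsCyclotomicExtension {p} ℚ (CyclotomicField p ℚ) := CyclotomicField.isCyclotomicExtension p ℚ
  obtain ⟨f, hf⟩ := exists_fun_pairwise_not_rel (dvd_and_le_natCard_of_dvd_classNumber (p := p)
    (CyclotomicField p ℚ) (dvd_classNumber_of_dvd_bernoulli_num hp2 (CyclotomicField p ℚ) hk h2k hkp hdvd)).2
  exact ⟨fun i => (f i).1, fun i => (f i).2, fun i j hij => hf hij⟩

end General

/-- **INFINITELY MANY PRIMES `p` DIVIDE THE NUMBER OF CONJUGACY CLASSES OF ELEMENTS OF ORDER `p` OF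
`GL_{p−1}(ℤ)`** — «there are infinitely many irregular primes» (Jensen; the tree's
`KummerCriterion.exists_gt_prime_dvd_classNumber_cyclotomicField`) read through `#C_p = h(ℚ(ζ_p))`.
[cite: Washington1997, Thm. 5.17] [cite: EdwardsFermat1977, §5.5] [cite: Brzezinski1990, (0.1) Theorem (with `f = Φ_p`), p. 21] -/
theorem infinite_setOf_prime_dvd_natCard_quot_isConj_orderOf_eq :
    {p : ℕ | p.Prime ∧ p ∣ Nat.card (Quot (fun g g' :
        {g : (_root_.Matrix (Fin (p - 1)) (Fin (p - 1)) ℤ)ˣ // orderOf g = p} => IsConj g.1 g'.1))}.Infinite := by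
  refine Set.infinite_of_forall_exists_gt fun N => ?_
  obtain ⟨p, hNp, hpr, hdvd⟩ := exists_gt_prime_dvd_classNumber_cyclotomicField N
  haveI : Fact p.Prime := ⟨hpr⟩
  haveI : IsCyclotomicExtension {p} ℚ (CyclotomicField p ℚ) := CyclotomicField.isCyclotomicExtension p ℚ
  exact ⟨p, ⟨hpr, (dvd_and_le_natCard_of_dvd_classNumber (CyclotomicField p ℚ) hdvd).1⟩, hNp⟩

section Quadratic

variable {p : ℕ} [hp : Fact p.Prime]

/-- **`h(ℚ(√−p))` DIVIDES THE NUMBER OF CONJUGACY CLASSES OF ELEMENTS OF ORDER `p` OF `GL_{p−1}(ℤ)`** for every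
prime `p ≡ 3 (mod 4)`, `p > 3`, and every quadratic number field `K ∋ √−p`: Okazaki's `h(K) ∣ h⁻(ℚ(ζ_p))` (the
tree's `classNumber_dvd_classNumber_div_of_sq_eq_neg`), `h⁻ ∣ h`, and `#C_p = h(ℚ(ζ_p))`.
[cite: Okazaki2000, §5 Cor. 29] [cite: Brzezinski1990, (0.1) Theorem (with `f = Φ_p`), p. 21] -/
theorem classNumber_dvd_natCard_quot_isConj_orderOf_eq_prime_of_sq_eq_neg (hp4 : p % 4 = 3) (hp3 : p ≠ 3)
    (K : Type*) [Field K] [NumberField K] (hK : Module.finrank ℚ K = 2) {x : K} (hx : x ^ 2 = -(p : K)) :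
    classNumber K ∣ Nat.card (Quot (fun g g' :
      {g : (_root_.Matrix (Fin (p - 1)) (Fin (p - 1)) ℤ)ˣ // orderOf g = p} => IsConj g.1 g'.1)) := by
  haveI : IsCyclotomicExtension {p} ℚ (CyclotomicField p ℚ) := CyclotomicField.isCyclotomicExtension p ℚ
  have hp2 : p ≠ 2 := by rintro rfl; norm_num at hp4
  exact (dvd_and_le_natCard_of_dvd_classNumber (CyclotomicField p ℚ) (dvd_classNumber_of_dvd_div hp2
    (CyclotomicField p ℚ) (classNumber_dvd_classNumber_div_of_sq_eq_neg hp4 hp3 K hK hx (CyclotomicField p ℚ)))).1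

end Quadratic

/-! ## §2 Instances -/

section Instances

/-- **`p = 31`: `3 ∣ #C_31`** — the number of conjugacy classes of elements of order `31` of `GL_{30}(ℤ)` is divisible
by `3` (`h(ℚ(√−31)) = 3 ∣ h⁻(ℚ(ζ_31)) ∣ h(ℚ(ζ_31))`). [cite: Okazaki2000, §5 Cor. 29] [cite: Cohen1993, Appendix B.1 («(−31,3,3)»)] [cite: Brzezinski1990, (0.1) Theorem (with `f = Φ_31`), p. 21] -/
theorem three_dvd_natCard_quot_isConj_orderOf_eq_thirtyOne :
    3 ∣ Nat.card (Quot (fun g g' : {g : (_root_.Matrix (Fin 30) (Fin 30) ℤ)ˣ // orderOf g = 31} =>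
        IsConj g.1 g'.1)) := by
  haveI : Fact (Nat.Prime 31) := ⟨by norm_num⟩
  haveI : IsCyclotomicExtension {31} ℚ (CyclotomicField 31 ℚ) := CyclotomicField.isCyclotomicExtension 31 ℚ
  exact (dvd_and_le_natCard_of_dvd_classNumber (p := 31) (CyclotomicField 31 ℚ) (dvd_classNumber_of_dvd_div
    (p := 31) (by norm_num) (CyclotomicField 31 ℚ) (three_dvd_classNumber_div_thirtyOne (CyclotomicField 31 ℚ)))).1

/-- **`p = 31`: three pairwise non-conjugate elements of order `31` in `GL_{30}(ℤ)`.** [cite: Okazaki2000, §5 Cor. 29] [cite: Cohen1993, Appendix B.1 («(−31,3,3)»)] [cite: Brzezinski1990, (0.1) Theorem (with `f = Φ_31`), p. 21] -/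
theorem exists_fun_pairwise_not_isConj_orderOf_eq_thirtyOne :
    ∃ g : Fin 3 → (_root_.Matrix (Fin 30) (Fin 30) ℤ)ˣ, (∀ i, orderOf (g i) = 31) ∧
      Pairwise fun i j => ¬ IsConj (g i) (g j) := by
  haveI : Fact (Nat.Prime 31) := ⟨by norm_num⟩
  haveI : IsCyclotomicExtension {31} ℚ (CyclotomicField 31 ℚ) := CyclotomicField.isCyclotomicExtension 31 ℚ
  obtain ⟨f, hf⟩ := exists_fun_pairwise_not_rel (dvd_and_le_natCard_of_dvd_classNumber (p := 31)
    (CyclotomicField 31 ℚ) (dvd_classNumber_of_dvd_div (p := 31) (by norm_num) (CyclotomicField 31 ℚ)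
      (three_dvd_classNumber_div_thirtyOne (CyclotomicField 31 ℚ)))).2
  exact ⟨fun i => (f i).1, fun i => (f i).2, fun i j hij => hf hij⟩

/-- **`p = 37`, THE FIRST IRREGULAR PRIME: `37 ∣ #C_37`** — the number of conjugacy classes of elements of order `37`
of `GL_{36}(ℤ)` is divisible by `37` (`37 ∣ B_32`, «37 divides the first factor of its class number»; the tree's
`KummerCriterion.dvd_classNumber_cyclotomicField_thirtySeven`). [cite: EdwardsFermat1977, §6.15] [cite: IrelandRosen1982, Ch. 15 §1 («ord_37(B_32) = 1»)] [cite: Brzezinski1990, (0.1) Theorem (with `f = Φ_37`), p. 21] -/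
theorem thirtySeven_dvd_natCard_quot_isConj_orderOf_eq_thirtySeven :
    37 ∣ Nat.card (Quot (fun g g' : {g : (_root_.Matrix (Fin 36) (Fin 36) ℤ)ˣ // orderOf g = 37} =>
        IsConj g.1 g'.1)) := by
  haveI : Fact (Nat.Prime 37) := ⟨by norm_num⟩
  haveI : IsCyclotomicExtension {37} ℚ (CyclotomicField 37 ℚ) := CyclotomicField.isCyclotomicExtension 37 ℚ
  exact (dvd_and_le_natCard_of_dvd_classNumber (p := 37) (CyclotomicField 37 ℚ)
    dvd_classNumber_cyclotomicField_thirtySeven).1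

/-- **`p = 37`: `GL_{36}(ℤ)` contains `37` elements of order `37` that are pairwise non-conjugate** (`#C_37 ≥ 37`).
[cite: EdwardsFermat1977, §6.15] [cite: Brzezinski1990, (0.1) Theorem (with `f = Φ_37`), p. 21] -/
theorem exists_fun_pairwise_not_isConj_orderOf_eq_thirtySeven :
    ∃ g : Fin 37 → (_root_.Matrix (Fin 36) (Fin 36) ℤ)ˣ, (∀ i, orderOf (g i) = 37) ∧
      Pairwise fun i j => ¬ IsConj (g i) (g j) := by
  haveI : Fact (Nat.Prime 37) := ⟨by norm_num⟩
  haveI : IsCyclotomicExtension {37} ℚ (CyclotomicField 37 ℚ) := CyclotomicField.isCyclotomicExtension 37 ℚ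
  obtain ⟨f, hf⟩ := exists_fun_pairwise_not_rel (dvd_and_le_natCard_of_dvd_classNumber (p := 37)
    (CyclotomicField 37 ℚ) dvd_classNumber_cyclotomicField_thirtySeven).2
  exact ⟨fun i => (f i).1, fun i => (f i).2, fun i j hij => hf hij⟩

/-- **`p = 47`: `5 ∣ #C_47`** (conjugacy classes of elements of order `47` of `GL_{46}(ℤ)`; `h(ℚ(√−47)) = 5`).
[cite: Okazaki2000, §5 Cor. 29] [cite: Cohen1993, Appendix B.1 («(−47,5,5)»)] [cite: Brzezinski1990, (0.1) Theorem (with `f = Φ_47`), p. 21] -/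
theorem five_dvd_natCard_quot_isConj_orderOf_eq_fortySeven :
    5 ∣ Nat.card (Quot (fun g g' : {g : (_root_.Matrix (Fin 46) (Fin 46) ℤ)ˣ // orderOf g = 47} =>
        IsConj g.1 g'.1)) := by
  haveI : Fact (Nat.Prime 47) := ⟨by norm_num⟩
  haveI : IsCyclotomicExtension {47} ℚ (CyclotomicField 47 ℚ) := CyclotomicField.isCyclotomicExtension 47 ℚ
  exact (dvd_and_le_natCard_of_dvd_classNumber (p := 47) (CyclotomicField 47 ℚ) (dvd_classNumber_of_dvd_div
    (p := 47) (by norm_num) (CyclotomicField 47 ℚ) (five_dvd_classNumber_div_fortySeven (CyclotomicField 47 ℚ)))).1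

/-- **`p = 59`, the second irregular prime: `3 · 59 = 177 ∣ #C_59`** (conjugacy classes of elements of order `59` of
`GL_{58}(ℤ)`; `h(ℚ(√−59)) = 3` and `59 ∣ num B_44`). [cite: Okazaki2000, §5 Cor. 29] [cite: EdwardsFermat1977, §6.19] [cite: IrelandRosen1982, Ch. 15 §1 («ord_59(B_44) = 1»)] [cite: Brzezinski1990, (0.1) Theorem (with `f = Φ_59`), p. 21] -/
theorem oneHundredSeventySeven_dvd_natCard_quot_isConj_orderOf_eq_fiftyNine :
    177 ∣ Nat.card (Quot (fun g g' : {g : (_root_.Matrix (Fin 58) (Fin 58) ℤ)ˣ // orderOf g = 59} =>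
        IsConj g.1 g'.1)) := by
  haveI : Fact (Nat.Prime 59) := ⟨by norm_num⟩
  haveI : IsCyclotomicExtension {59} ℚ (CyclotomicField 59 ℚ) := CyclotomicField.isCyclotomicExtension 59 ℚ
  exact (dvd_and_le_natCard_of_dvd_classNumber (p := 59) (CyclotomicField 59 ℚ) (dvd_classNumber_of_dvd_div
    (p := 59) (by norm_num) (CyclotomicField 59 ℚ)
      (three_mul_fiftyNine_dvd_classNumber_div_fiftyNine (CyclotomicField 59 ℚ)))).1

/-- **`p = 59`: `GL_{58}(ℤ)` contains `177` pairwise non-conjugate elements of order `59`.** [cite: Okazaki2000, §5 Cor. 29] [cite: EdwardsFermat1977, §6.19] [cite: Brzezinski1990, (0.1) Theorem (with `f = Φ_59`), p. 21] -/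
theorem exists_fun_pairwise_not_isConj_orderOf_eq_fiftyNine :
    ∃ g : Fin 177 → (_root_.Matrix (Fin 58) (Fin 58) ℤ)ˣ, (∀ i, orderOf (g i) = 59) ∧
      Pairwise fun i j => ¬ IsConj (g i) (g j) := by
  haveI : Fact (Nat.Prime 59) := ⟨by norm_num⟩
  haveI : IsCyclotomicExtension {59} ℚ (CyclotomicField 59 ℚ) := CyclotomicField.isCyclotomicExtension 59 ℚ
  obtain ⟨f, hf⟩ := exists_fun_pairwise_not_rel (dvd_and_le_natCard_of_dvd_classNumber (p := 59)
    (CyclotomicField 59 ℚ) (dvd_classNumber_of_dvd_div (p := 59) (by norm_num) (CyclotomicField 59 ℚ)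
      (three_mul_fiftyNine_dvd_classNumber_div_fiftyNine (CyclotomicField 59 ℚ)))).2
  exact ⟨fun i => (f i).1, fun i => (f i).2, fun i j hij => hf hij⟩

/-- **`p = 67`, the third irregular prime: `67 ∣ #C_67`** (conjugacy classes of elements of order `67` of
`GL_{66}(ℤ)`; `67 ∣ num B_58`, the tree's `KummerCriterion.dvd_classNumber_cyclotomicField_sixtySeven`).
[cite: IrelandRosen1982, Ch. 15 §1] [cite: EdwardsFermat1977, §6.19] [cite: Brzezinski1990, (0.1) Theorem (with `f = Φ_67`), p. 21] -/
theorem sixtySeven_dvd_natCard_quot_isConj_orderOf_eq_sixtySeven :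
    67 ∣ Nat.card (Quot (fun g g' : {g : (_root_.Matrix (Fin 66) (Fin 66) ℤ)ˣ // orderOf g = 67} =>
        IsConj g.1 g'.1)) := by
  haveI : Fact (Nat.Prime 67) := ⟨by norm_num⟩
  haveI : IsCyclotomicExtension {67} ℚ (CyclotomicField 67 ℚ) := CyclotomicField.isCyclotomicExtension 67 ℚ
  exact (dvd_and_le_natCard_of_dvd_classNumber (p := 67) (CyclotomicField 67 ℚ)
    dvd_classNumber_cyclotomicField_sixtySeven).1

/-- **`p = 71`: `7 ∣ #C_71`** (conjugacy classes of elements of order `71` of `GL_{70}(ℤ)`; `h(ℚ(√−71)) = 7`).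
[cite: Okazaki2000, §5 Cor. 29] [cite: Cohen1993, Appendix B.1 («(−71,7,7)»)] [cite: Brzezinski1990, (0.1) Theorem (with `f = Φ_71`), p. 21] -/
theorem seven_dvd_natCard_quot_isConj_orderOf_eq_seventyOne :
    7 ∣ Nat.card (Quot (fun g g' : {g : (_root_.Matrix (Fin 70) (Fin 70) ℤ)ˣ // orderOf g = 71} =>
        IsConj g.1 g'.1)) := by
  haveI : Fact (Nat.Prime 71) := ⟨by norm_num⟩
  haveI : IsCyclotomicExtension {71} ℚ (CyclotomicField 71 ℚ) := CyclotomicField.isCyclotomicExtension 71 ℚ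
  exact (dvd_and_le_natCard_of_dvd_classNumber (p := 71) (CyclotomicField 71 ℚ) (dvd_classNumber_of_dvd_div
    (p := 71) (by norm_num) (CyclotomicField 71 ℚ) (seven_dvd_classNumber_div_seventyOne (CyclotomicField 71 ℚ)))).1

/-- **`p = 103`: `103 ∣ #C_103`** (conjugacy classes of elements of order `103` of `GL_{102}(ℤ)`; `103 ∣ num B_24`,
the tree's `KummerCriterion.dvd_classNumber_cyclotomicField_oneHundredThree`). [cite: IrelandRosen1982, Ch. 15 §1 («The first few irregular primes are 37, 59, 67, 101, 103, 149 and 157»)] [cite: EdwardsFermat1977, §6.16, Theorem] [cite: Brzezinski1990, (0.1) Theorem (with `f = Φ_103`), p. 21] -/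
theorem oneHundredThree_dvd_natCard_quot_isConj_orderOf_eq_oneHundredThree :
    103 ∣ Nat.card (Quot (fun g g' : {g : (_root_.Matrix (Fin 102) (Fin 102) ℤ)ˣ // orderOf g = 103} =>
        IsConj g.1 g'.1)) := by
  haveI : Fact (Nat.Prime 103) := ⟨by norm_num⟩
  haveI : IsCyclotomicExtension {103} ℚ (CyclotomicField 103 ℚ) := CyclotomicField.isCyclotomicExtension 103 ℚ
  exact (dvd_and_le_natCard_of_dvd_classNumber (p := 103) (CyclotomicField 103 ℚ)
    dvd_classNumber_cyclotomicField_oneHundredThree).1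

/-- **`p = 691`: `691 ∣ #C_691`** — the number of conjugacy classes of elements of order `691` of `GL_{690}(ℤ)` is
divisible by `691` (`691 ∣ B_12 = −691/2730`, the tree's `KummerCriterion.dvd_classNumber_cyclotomicField_sixHundredNinetyOne`).
[cite: IrelandRosen1982, Ch. 15 §1 and Exercise 1] [cite: EdwardsFermat1977, §6.16, Theorem] [cite: Brzezinski1990, (0.1) Theorem (with `f = Φ_691`), p. 21] -/
theorem sixHundredNinetyOne_dvd_natCard_quot_isConj_orderOf_eq_sixHundredNinetyOne :
    691 ∣ Nat.card (Quot (fun g g' : {g : (_root_.Matrix (Fin 690) (Fin 690) ℤ)ˣ // orderOf g = 691} =>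
        IsConj g.1 g'.1)) := by
  haveI : Fact (Nat.Prime 691) := ⟨by norm_num⟩
  haveI : IsCyclotomicExtension {691} ℚ (CyclotomicField 691 ℚ) := CyclotomicField.isCyclotomicExtension 691 ℚ
  exact (dvd_and_le_natCard_of_dvd_classNumber (p := 691) (CyclotomicField 691 ℚ)
    dvd_classNumber_cyclotomicField_sixHundredNinetyOne).1

/-- **`p = 691`: `GL_{690}(ℤ)` contains `691` pairwise non-conjugate elements of order `691`.** [cite: IrelandRosen1982, Ch. 15 §1 and Exercise 1] [cite: Brzezinski1990, (0.1) Theorem (with `f = Φ_691`), p. 21] -/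
theorem exists_fun_pairwise_not_isConj_orderOf_eq_sixHundredNinetyOne :
    ∃ g : Fin 691 → (_root_.Matrix (Fin 690) (Fin 690) ℤ)ˣ, (∀ i, orderOf (g i) = 691) ∧
      Pairwise fun i j => ¬ IsConj (g i) (g j) := by
  haveI : Fact (Nat.Prime 691) := ⟨by norm_num⟩
  haveI : IsCyclotomicExtension {691} ℚ (CyclotomicField 691 ℚ) := CyclotomicField.isCyclotomicExtension 691 ℚ
  obtain ⟨f, hf⟩ := exists_fun_pairwise_not_rel (dvd_and_le_natCard_of_dvd_classNumber (p := 691)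
    (CyclotomicField 691 ℚ) dvd_classNumber_cyclotomicField_sixHundredNinetyOne).2
  exact ⟨fun i => (f i).1, fun i => (f i).2, fun i j hij => hf hij⟩

end Instances

end Literature.LinearAlgebra.Matrix.CyclotomicIntegerMatrixClassesIrregularPrimes
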